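/-
Copyright: cell pub-balaban-gaps (YM BLITZ Y1, track G1), seat g1-p2 GEN 9 (unit `pub-balaban-gaps-g1-p2`).  Row (D4) NODE O,
the (3.35) DICTIONARY of `D4WalkBlockReg335Dictionary` in PRINT'S NORM: lit-balaban's `Reg335Cube` instantiated with matrices normed by
the `ℓ²`-OPERATOR norm (the operator norm on `ℂ^N` — print's `|·|` on `G ⊂ U(N)`, `𝔤 ⊂ u(N)`), and the row-sum windows of this lineage
derived from it with the explicit FIBRE FACTOR `N` (`Σ_c|M_{ac}| ≤ N·‖M‖₂`): the census's dictionary (ν) as a lemma, honest about the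
constant.  HONEST FRAMING: bookkeeping; the unitarity clause `‖u‖, ‖u⁻¹‖ ≤ 1` now means what print means (contractions of `ℂ^N`), at
the price of row sums `≤ N` for the gauge and `N·(window)` for the field; geometry as in 96 (□ = T, one scale); nothing of Bałaban's
asserted; (D4) instance 0∕1; NOT BetaPertH, NOT continuum, NOT Clay.
-/
import Summits.QuantumFields.BalabanUV.Gaps.D4WalkBlockReg335Dictionary
import Mathlib.Analysis.CStarAlgebra.Matrix
import Literature.Barriers.QuantumFields.UnitaryHaarSmallBall

/-!
# `Gaps.D4WalkBlockReg335DictionaryL2` — `Reg335Cube` in the `ℓ²`-operator norm ⟹ the gauge hypotheses with fibre factor `N`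
# (cell pub-balaban-gaps, seat g1-p2 gen 9)

HONEST DEPENDENCY (cell pub-balaban, verbatim): continuum YM on T⁴ ⇐ BetaPertH ∧ nine spine estimates (0/9 proved);
BetaPertH ⇐ (D1) ∧ (D4) ∧ CAP+tail.

* (`‖M_{ij}‖ ≤ ‖M‖₂` is the tree's `Literature.Barriers.QuantumFields.norm_entry_le_l2_opNorm`), `rowSumNorm_le_card_mul_l2OpNorm` (`Σ_c‖M_{ac}‖ ≤ N·‖M‖₂`);
* **`gaugeHyps_of_reg335Cube_torus_l2`**: 96's `gauge_data_of_reg335Cube` at `𝔸 = Matrix (Fin N) (Fin N) ℂ` in the `ℓ²`-operator norm ⟹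
  `g`, `g⁻` two-sided inverse with row sums `≤ N`, the two gauge relations with `exp (±X)`, row-sum windows `N|η|Cξ⁻¹`, `N|η|²Cξ⁻²`.
References: T. Bałaban, Comm. Math. Phys. **99** (1985) 389–434 [B9], (3.35) p. 396, p. 390 (norms on `G`, `𝔤`).
-/

noncomputable section

namespace Summit.QuantumFields.BalabanUV.Gaps.D4WalkBlockReg335DictionaryL2

open Complex NormedSpace
open scoped Matrix
open Literature.MathematicalPhysics.QuantumFieldTheory.Balaban1983to89
open Literature.MathematicalPhysics.QuantumFieldTheory.Balaban1983to89.B9Eq335RegularityClasses (Reg335Cube)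
open Literature.MathematicalPhysics.QuantumFieldTheory.Balaban1983to89.B4Reflection242 (boxDom)
open Literature.MathematicalPhysics.QuantumFieldTheory.Balaban1983to89.B6MultiLevelBoxOperator (N0)
open Literature.MathematicalPhysics.QuantumFieldTheory.Balaban1983to89.B6MultiLevelTorusOperator (tshift unitVec)
open Summit.QuantumFields.BalabanUV.Gaps.D4WalkBlockTransportAlgebra (rowSumNorm)
open Summit.QuantumFields.BalabanUV.Gaps.D4WalkBlockReg335Dictionary (gauge_data_of_reg335Cube)
open Literature.Barriers.QuantumFields (norm_entry_le_l2_opNorm)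

section L2

open scoped Matrix.Norms.L2Operator

variable {N : ℕ}

/-- Row sums against the `ℓ²`-operator norm: `Σ_c‖M_{ac}‖ ≤ N·‖M‖₂` (the fibre factor of the census's dictionary (ν)). -/
theorem rowSumNorm_le_card_mul_l2OpNorm (A : Matrix (Fin N) (Fin N) ℂ) (a : Fin N) : rowSumNorm A a ≤ (N : ℝ) * ‖A‖ := by
  unfold rowSumNorm
  calc ∑ c, ‖A a c‖ ≤ ∑ _c : Fin N, ‖A‖ := Finset.sum_le_sum fun c _ => norm_entry_le_l2_opNorm A a c
    _ = (N : ℝ) * ‖A‖ := by simp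

variable {d ℓ Mh k : ℕ} {P : Fin (d + 1) → ℕ}

/-- **THE GAUGE HYPOTHESES FROM `Reg335Cube` IN PRINT'S NORM (`ℓ²`-operator), WITH THE FIBRE FACTOR `N`**: `g`, `g⁻` with two-sided
inverse and row sums `≤ N` (from `‖u‖, ‖u⁻¹‖ ≤ 1`), the gauge relations `g(y)U_μ(y)g⁻(y+e_μ) = exp (X_μ y)`,
`g(y+e_μ)U_μ(y)⁻¹g⁻(y) = exp (−X_μ y)`, and row-sum windows `Σ_c‖X_μ(y)_{ac}‖ ≤ N|η|Cξ⁻¹`, `Σ_c‖(X_μ(x) − X_μ(x − e_μ))_{ac}‖ ≤ N|η|²Cξ⁻²`.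
[cite: Balaban1985BackgroundPropagators, (3.35) p.396, p.390] -/
theorem gaugeHyps_of_reg335Cube_torus_l2 (U : Fin (d + 1) → ↥(boxDom (N0 ℓ Mh k P)) → (Matrix (Fin N) (Fin N) ℂ)ˣ) {η ξ C : ℝ}
    (hη : η ≠ 0)
    (h : Reg335Cube (fun ν => tshift (N0 ℓ Mh k P) (unitVec ν)) U η (Set.univ : Set ↥(boxDom (N0 ℓ Mh k P))) ξ C) :
    ∃ (g gi : ↥(boxDom (N0 ℓ Mh k P)) → Matrix (Fin N) (Fin N) ℂ) (X : Fin (d + 1) → ↥(boxDom (N0 ℓ Mh k P)) → Matrix (Fin N) (Fin N) ℂ),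
      (∀ x, g x * gi x = 1) ∧ (∀ x, gi x * g x = 1) ∧ (∀ x a, ∑ b, ‖gi x a b‖ ≤ (N : ℝ)) ∧ (∀ x a, ∑ b, ‖g x a b‖ ≤ (N : ℝ)) ∧
      (∀ ν y, g y * (U ν y : Matrix (Fin N) (Fin N) ℂ) * gi ((tshift (N0 ℓ Mh k P) (unitVec ν)) y) = exp (X ν y)) ∧
      (∀ ν y, g ((tshift (N0 ℓ Mh k P) (unitVec ν)) y) * (((U ν y)⁻¹ : (Matrix (Fin N) (Fin N) ℂ)ˣ) : Matrix (Fin N) (Fin N) ℂ) * gi y =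
        exp (-X ν y)) ∧
      (∀ ν y a, rowSumNorm (X ν y) a ≤ (N : ℝ) * (|η| * C * ξ⁻¹)) ∧
      (∀ ν x a, rowSumNorm (X ν x - X ν ((tshift (N0 ℓ Mh k P) (unitVec ν)).symm x)) a ≤ (N : ℝ) * (|η| ^ 2 * C * (ξ ^ 2)⁻¹)) := by
  obtain ⟨g, gi, X, hg, hgi, hng, hngi, hrel, hreli, hX0, hX1⟩ := gauge_data_of_reg335Cube _ U hη h
  have hN : (0 : ℝ) ≤ N := Nat.cast_nonneg N
  refine ⟨g, gi, X, hg, hgi, fun x a => ?_, fun x a => ?_, hrel, hreli, fun ν y a => ?_, fun ν x a => ?_⟩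
  · exact (rowSumNorm_le_card_mul_l2OpNorm (gi x) a).trans (by simpa using mul_le_mul_of_nonneg_left (hngi x) hN)
  · exact (rowSumNorm_le_card_mul_l2OpNorm (g x) a).trans (by simpa using mul_le_mul_of_nonneg_left (hng x) hN)
  · exact (rowSumNorm_le_card_mul_l2OpNorm _ a).trans (mul_le_mul_of_nonneg_left (hX0 ν y) hN)
  · exact (rowSumNorm_le_card_mul_l2OpNorm _ a).trans (mul_le_mul_of_nonneg_left (hX1 ν x) hN)

end L2

end Summit.QuantumFields.BalabanUV.Gaps.D4WalkBlockReg335DictionaryL2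

end
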